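import Summits.CriticalPhenomena.SAWScalingLimit.Theses.SAWLeftRightFKG
import Summits.CriticalPhenomena.SAWScalingLimit.Theorems.BoundaryTP2Negative_Box3
import Literature.Topology.PlaneTopology.WindingNumberCrossing

/-!
# Sketch (crux-ideate, ideator 1) for crux `NotFKGAtOne` (stmt-CriticalPhenomena-11233)

First lemmas of the two idea cards `one-jump-corner-certificate` and
`corner-determinant-transfer`.  Witness: the 3 × 3 vertex box `{0,1,2}²` cut out by the closed
lattice walk `C = ∂[-1,3]²`, chords `(0,0) → (2,2)` (12 of them), events
`A = {first step up}` (6), `B = {last step enters (2,2) from the left}` (6), `A ∩ B` (2):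
`6 · 6 = 36 > 12 · 2 = 24`.
-/

namespace Summit.CriticalPhenomena.SAWScalingLimit.Cruxes.NotFKGAtOne.SketchIdeator1

open MeasureTheory Literature.Probability.LatticeModels Literature.Probability.RandomPlanarGeometry
  Literature.Topology.PlaneTopology
open Summit.CriticalPhenomena.SAWScalingLimit.Theorems.BoundaryTP2.Negative

noncomputable section

/-! ## The crux's objects, named -/

/-- The crux's domain: points of non-zero winding number of the closed lattice walk `C` at mesh `δ`. -/
def windDomain {c : Site 2} (C : (zdGraph 2).Walk c c) (δ : ℝ) : Set ℂ :=
  {z | wind (fun t : ℝ => Set.IccExtend zero_le_one (C.toCurve (meshPoint δ)) t - z) ≠ 0}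

/-- The crux's lens loop of two chords, read on `ℝ`, minus the point `z`. -/
def lensSub {Ω : Set ℂ} {δ : ℝ} {a b : Site 2} (γ₁ γ₂ : SAW.DomainSAW Ω δ a b) (z : ℂ) : ℝ → ℂ :=
  fun t : ℝ => Set.IccExtend zero_le_one ((γ₁.walk.append γ₂.walk.reverse).toCurve (meshPoint δ)) t - z

/-- The crux's left–right preorder `γ₁ ≼ γ₂ :⟺ ∀ z, 0 ≤ wind (lens γ₁ γ₂⁻¹ − z)`. -/
def lensLE {Ω : Set ℂ} {δ : ℝ} {a b : Site 2} (γ₁ γ₂ : SAW.DomainSAW Ω δ a b) : Prop :=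
  ∀ z : ℂ, 0 ≤ wind (lensSub γ₁ γ₂ z)

/-! ## Card `one-jump-corner-certificate`: first lemma = the source-corner jump

Every winding number the certificate needs is `0` (exterior base point, Rouché / ball lemma
`Curve.wind_eq_zero_of_subset_ball`, or a probe missing the loop, `wind_affine_sub_eq_of_segment`)
or ONE transversal jump away from `0` (`wind_sub_wind_of_straight_cross`).  At the source corner
`a = (0,0)`: if `γ₁` starts upward and `γ₂` starts to the right, the vertical probe from the
exterior point `r = ½ - ½ i` to the corner-face centre `ℓ = ½ + ½ i` crosses the lens loop
`γ₁ · γ₂⁻¹` exactly once, through the edge `(1,0) → (0,0)` (negative side to positive side), so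
`wind (lens − ℓ) = wind (lens − r) − 1 = −1 < 0`: `γ₁ ⋠ γ₂`.  Contrapositive = `{first step up}` is
`≼`-up-closed.  (Symmetrically at the target corner for `{last step from the left}`.) -/

/-- FIRST LEMMA (card 1): the source-corner jump. -/
theorem wind_lens_sourceCorner {Ω : Set ℂ} {b : Site 2} (γ₁ γ₂ : SAW.DomainSAW Ω 1 ![0, 0] b)
    (h₁ : γ₁.walk.getVert 1 = ![0, 1]) (h₂ : γ₂.walk.getVert 1 = ![1, 0])
    (hbox : ∀ v, v ∈ γ₁.walk.support ∨ v ∈ γ₂.walk.support → v ∈ boxSites ![0, 0] ![2, 2]) :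
    wind (lensSub γ₁ γ₂ ⟨1 / 2, 1 / 2⟩) = -1 := by
  sorry

/-- Hence `{first step up}` is up-closed for the crux order, inside any domain whose chords from the
corner `(0,0)` stay in the box and leave it upward or to the right. -/
theorem firstStepUp_upClosed {Ω : Set ℂ} {b : Site 2} (γ₁ γ₂ : SAW.DomainSAW Ω 1 ![0, 0] b)
    (hbox : ∀ v, v ∈ γ₁.walk.support ∨ v ∈ γ₂.walk.support → v ∈ boxSites ![0, 0] ![2, 2])
    (h₂ : γ₂.walk.getVert 1 = ![0, 1] ∨ γ₂.walk.getVert 1 = ![1, 0])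
    (hle : lensLE γ₁ γ₂) (h₁ : γ₁.walk.getVert 1 = ![0, 1]) : γ₂.walk.getVert 1 = ![0, 1] := by
  rcases h₂ with h₂ | h₂
  · exact h₂
  · exfalso
    have h := hle ⟨1 / 2, 1 / 2⟩
    rw [wind_lens_sourceCorner γ₁ γ₂ h₁ h₂ hbox] at h
    exact absurd h (by norm_num)

/-- The target-corner jump (horizontal probe from `5/2 + 3/2 i` to the face centre `3/2 + 3/2 i`,
crossing the last edge `(2,1) → (2,2)` of `γ₂` once): `{last step from the left}` is up-closed. -/
theorem wind_lens_targetCorner {Ω : Set ℂ} (γ₁ γ₂ : SAW.DomainSAW Ω 1 ![0, 0] ![2, 2])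
    (h₁ : γ₁.walk.getVert (γ₁.length - 1) = ![1, 2]) (h₂ : γ₂.walk.getVert (γ₂.length - 1) = ![2, 1])
    (hbox : ∀ v, v ∈ γ₁.walk.support ∨ v ∈ γ₂.walk.support → v ∈ boxSites ![0, 0] ![2, 2]) :
    wind (lensSub γ₁ γ₂ ⟨3 / 2, 3 / 2⟩) = -1 := by
  sorry

/-! ## Shared: the wind-domain of the square `∂[-1,3]²` has the discrete domain graph of `Box3`'s `Ω₃` -/

/-- DOMAIN IDENTIFICATION (stub of both cards): for the boundary walk of the lattice square
`[-1,3]²`, the crux's discrete domain graph at `δ = 1` is `ℤ²` induced on the box `{0,1,2}²`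
— the same adjacency as `Theorems.BoundaryTP2.Negative.adj₃_iff` for `Ω₃`, so `nb₃`, `pathsFrom`,
`length_le_eight`-style bounds transfer verbatim.  (Sister disproof, parts BoxDomain/BoxMesh:
`meshDomain_Ωb`, `dAdj_iff`; self-contained: 9 interior lattice points by one jump across the
bottom side + `wind_affine_sub_eq_of_segment`, exterior points by `Curve.wind_eq_zero_of_subset_ball`,
boundary points by `Curve.wind_of_mem_range`.) -/
theorem adjSq_iff (C : (zdGraph 2).Walk ![-1, -1] ![-1, -1])
    (hC : C.support = [![-1,-1], ![0,-1], ![1,-1], ![2,-1], ![3,-1], ![3,0], ![3,1], ![3,2], ![3,3],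
      ![2,3], ![1,3], ![0,3], ![-1,3], ![-1,2], ![-1,1], ![-1,0], ![-1,-1]]) {x y : Site 2} :
    (discreteDomainGraph (windDomain C 1) 1).Adj x y ↔
      (zdGraph 2).Adj x y ∧ x ∈ boxSites ![0, 0] ![2, 2] ∧ y ∈ boxSites ![0, 0] ![2, 2] := by
  sorry

/-! ## Card `corner-determinant-transfer`: first lemma = the certified corner census of the box

`pathsFrom` (tree, `BoundaryTP2Negative_Enumeration`) lists the 12 chord supports; the four
first/last-step classes have length multisets `UL = {4,4}`, `RB = {4,4}`, `UB = RL = {4,6,6,8}`,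
so `w(A)w(B) − w(U)w(A∩B) = Z_UB·Z_RL − Z_UL·Z_RB = (x⁴+2x⁶+x⁸)² − 4x⁸ = x⁸(2x²+x⁴−1)(3+2x²+x⁴)`:
PA fails on this pair for EVERY fugacity with `2x² + x⁴ > 1` (`x > (√2−1)^{1/2} = 0.6436`, the
sister disproof's `x₀(3×3) = .643594`), in particular at `x = 1` (counting measure). -/

/-- First step of a support list goes up (`(0,0) → (0,1)`). -/
def firstUp (s : List (Site 2)) : Bool :=
  match s with
  | _ :: v :: _ => eqSite v ![0, 1]
  | _ => false

/-- Last step of a support list enters `(2,2)` from the left (`(1,2) → (2,2)`). -/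
def lastFromLeft (s : List (Site 2)) : Bool :=
  match s.reverse with
  | _ :: v :: _ => eqSite v ![1, 2]
  | _ => false

/-- The enumerated chord supports `(0,0) → (2,2)` of the box. -/
def chords₃ : List (List (Site 2)) := (pathsFrom eqSite nb₃ 8 ![0, 0] []).filter (endsAt eqSite ![2, 2])

/-- FIRST LEMMA (card 2): the corner census, kernel-decided — 12 chords; 6 start up; 6 end from the
left; 2 do both (lengths 4,4); the mixed classes have lengths {4,6,6,8}. -/
theorem corner_census :
    chords₃.length = 12 ∧ (chords₃.filter firstUp).length = 6 ∧ (chords₃.filter lastFromLeft).length = 6 ∧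
    ((chords₃.filter fun s => firstUp s && lastFromLeft s).map fun s => s.length - 1) = [4, 4] ∧
    ((chords₃.filter fun s => !firstUp s && !lastFromLeft s).map fun s => s.length - 1) = [4, 4] ∧
    (let UB := (chords₃.filter fun s => firstUp s && !lastFromLeft s).map fun s => s.length - 1
     UB.length = 4 ∧ UB.count 4 = 1 ∧ UB.count 6 = 2 ∧ UB.count 8 = 1) ∧
    (let RL := (chords₃.filter fun s => !firstUp s && lastFromLeft s).map fun s => s.length - 1
     RL.length = 4 ∧ RL.count 4 = 1 ∧ RL.count 6 = 2 ∧ RL.count 8 = 1) ∧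
    chords₃.Nodup := by
  decide

/-- The corner determinant of the 3 × 3 box factorises. -/
theorem cornerDet₃ (x : ℝ) :
    (x ^ 4 + 2 * x ^ 6 + x ^ 8) ^ 2 - (2 * x ^ 4) * (2 * x ^ 4) =
      x ^ 8 * (2 * x ^ 2 + x ^ 4 - 1) * (3 + 2 * x ^ 2 + x ^ 4) := by
  ring

/-- … and is positive exactly when `2x² + x⁴ > 1`; at `x = 1`: `16 − 4 = 12 > 0`. -/
theorem cornerDet₃_pos {x : ℝ} (hx : 0 < x) (h : 1 < 2 * x ^ 2 + x ^ 4) :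
    (2 * x ^ 4) * (2 * x ^ 4) < (x ^ 4 + 2 * x ^ 6 + x ^ 8) ^ 2 := by
  have h8 : 0 < x ^ 8 := by positivity
  have : 0 < x ^ 8 * (2 * x ^ 2 + x ^ 4 - 1) * (3 + 2 * x ^ 2 + x ^ 4) := by
    have h3 : 0 < 3 + 2 * x ^ 2 + x ^ 4 := by positivity
    have h1 : 0 < 2 * x ^ 2 + x ^ 4 - 1 := by linarith
    positivity
  nlinarith [cornerDet₃ x]

/-- The fugacity-`x` weight (sister disproof `Cruxes/LeftRightFKG/Disproof.lean`, verbatim). -/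
def weightAt (x : ℝ) (Ω : Set ℂ) (δ : ℝ) (a b : Site 2) : Measure (SAW.DomainSAW Ω δ a b) :=
  Measure.sum fun γ => ENNReal.ofReal (x ^ γ.length) • Measure.dirac γ

/-- TRANSFER, measure half: at `x = 1` the weight IS Mathlib's counting measure (`count := sum dirac`). -/
theorem weightAt_one (Ω : Set ℂ) (δ : ℝ) (a b : Site 2) : weightAt 1 Ω δ a b = Measure.count := by
  simp [weightAt, Measure.count]

/-- The sister disproof's parametric statement `LeftRightFKGAt x` (verbatim). -/
def LeftRightFKGAt (x : ℝ) : Prop :=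
  ∀ (δ : ℝ) (c a b a' b' : Site 2) (C : (zdGraph 2).Walk c c),
    let Ω : Set ℂ := {z | wind (fun t : ℝ => Set.IccExtend zero_le_one (C.toCurve (meshPoint δ)) t - z) ≠ 0}
    let le : SAW.DomainSAW Ω δ a b → SAW.DomainSAW Ω δ a b → Prop := fun γ₁ γ₂ => ∀ z : ℂ,
      0 ≤ wind (fun t : ℝ => Set.IccExtend zero_le_one ((γ₁.walk.append γ₂.walk.reverse).toCurve (meshPoint δ)) t - z)
    0 < δ → a' ∈ C.support → b' ∈ C.support → (zdGraph 2).Adj a a' → (zdGraph 2).Adj b b' →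
    ∀ A B : Set (SAW.DomainSAW Ω δ a b), (∀ γ₁ γ₂, le γ₁ γ₂ → γ₁ ∈ A → γ₂ ∈ A) →
      (∀ γ₁ γ₂, le γ₁ γ₂ → γ₁ ∈ B → γ₂ ∈ B) →
      weightAt x Ω δ a b A * weightAt x Ω δ a b B ≤ weightAt x Ω δ a b Set.univ * weightAt x Ω δ a b (A ∩ B)

/-- TRANSFER C⁺ (card 2): the parametric negative on the ray `2x² + x⁴ > 1` (same certificate). -/
theorem not_leftRightFKGAt_of_cornerDet {x : ℝ} (hx : 0 < x) (h : 1 < 2 * x ^ 2 + x ^ 4) :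
    ¬ LeftRightFKGAt x := by
  sorry

/-- TRANSFER, logical half: `C⁺` at `x = 1` is the crux, by `weightAt_one`. -/
theorem notFKGAtOne_of_not_leftRightFKGAt_one (h : ¬ LeftRightFKGAt 1) :
    Theses.SAWLeftRightFKG.NotFKGAtOne := by
  intro hall
  apply h
  intro δ c a b a' b' C Ω le hδ ha hb haa hbb A B hA hB
  simpa only [weightAt_one] using hall δ c a b a' b' C hδ ha hb haa hbb A B hA hB

/-- Hence the crux from the corner determinant at `x = 1` (`2 + 1 = 3 > 1`). -/
theorem notFKGAtOne_of_cornerDet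
    (h : ∀ x : ℝ, 0 < x → 1 < 2 * x ^ 2 + x ^ 4 → ¬ LeftRightFKGAt x) :
    Theses.SAWLeftRightFKG.NotFKGAtOne :=
  notFKGAtOne_of_not_leftRightFKGAt_one (h 1 one_pos (by norm_num))

/-! ## Composition with the standing disproof's reduction (`Disproof.lean`, cycle 1)

The refuter reduced the crux, sorry-free, to `Disproof.Witness3x3` (`notFKGAtOne_of_witness3x3`): two
up-closedness conjuncts + four counts for `C = sq3 = ∂[-1,3]²`, `a = P 0 0`, `b = P 2 2`,
`A = {getVert 1 = P 0 1}`, `B = {reverse.getVert 1 = P 1 2}`.  Both cards target exactly these conjuncts: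
`Disproof.lr` is this file's `lensLE` (same definiens), `Disproof.P x y = ![x, y]`. -/

section Compose

/-! ### Verbatim copies from `Cruxes/NotFKGAtOne/Disproof.lean` (cycle 1) — the Cruxes workfile is not an
importable farm module at check time; these are its `dom`, `lr`, `CountFKG`, `notFKGAtOne_iff`, `P`, `stepTo`,
`sq3`, `mem_sq3_support_a'/b'`, `Witness3x3`, `notFKGAtOne_of_witness3x3`, unchanged. -/
namespace DisproofCopy

open scoped ENNReal

/-- [copy] `Ω(C, δ)`. -/
def dom (δ : ℝ) {c : Site 2} (C : (zdGraph 2).Walk c c) : Set ℂ :=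
  {z | wind (fun t : ℝ => Set.IccExtend zero_le_one (C.toCurve (meshPoint δ)) t - z) ≠ 0}

/-- [copy] the crux preorder. -/
def lr {Ω : Set ℂ} {δ : ℝ} {a b : Site 2} (γ₁ γ₂ : SAW.DomainSAW Ω δ a b) : Prop :=
  ∀ z : ℂ, 0 ≤ wind (fun t : ℝ =>
    Set.IccExtend zero_le_one ((γ₁.walk.append γ₂.walk.reverse).toCurve (meshPoint δ)) t - z)

/-- [copy] the ∀-body of the crux at one datum. -/
def CountFKG (δ : ℝ) (c a b a' b' : Site 2) (C : (zdGraph 2).Walk c c) : Prop :=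
  0 < δ → a' ∈ C.support → b' ∈ C.support → (zdGraph 2).Adj a a' → (zdGraph 2).Adj b b' →
  ∀ A B : Set (SAW.DomainSAW (dom δ C) δ a b), (∀ γ₁ γ₂, lr γ₁ γ₂ → γ₁ ∈ A → γ₂ ∈ A) →
    (∀ γ₁ γ₂, lr γ₁ γ₂ → γ₁ ∈ B → γ₂ ∈ B) →
    Measure.count A * Measure.count B ≤
      Measure.count (Set.univ : Set (SAW.DomainSAW (dom δ C) δ a b)) * Measure.count (A ∩ B)

/-- [copy] read-back. -/
theorem notFKGAtOne_iff :
    Theses.SAWLeftRightFKG.NotFKGAtOne ↔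
      ∃ (δ : ℝ) (c a b a' b' : Site 2) (C : (zdGraph 2).Walk c c), ¬ CountFKG δ c a b a' b' C := by
  have h : Theses.SAWLeftRightFKG.NotFKGAtOne ↔ ¬ ∀ (δ : ℝ) (c a b a' b' : Site 2) (C : (zdGraph 2).Walk c c),
      CountFKG δ c a b a' b' C := Iff.rfl
  simp only [h, not_forall]

/-- [copy] lattice point. -/
def P (x y : ℤ) : Site 2 := ![x, y]

/-- [copy] one explicit step. -/
abbrev stepTo {u w : Site 2} (v : Site 2) (h : (zdGraph 2).Adj u v) (p : (zdGraph 2).Walk v w) :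
    (zdGraph 2).Walk u w :=
  SimpleGraph.Walk.cons h p

/-- [copy] `C₃ = ∂[-1,3]²`. -/
def sq3 : (zdGraph 2).Walk (P (-1) (-1)) (P (-1) (-1)) :=
  stepTo (P 0 (-1)) (by decide) <| stepTo (P 1 (-1)) (by decide) <| stepTo (P 2 (-1)) (by decide) <|
  stepTo (P 3 (-1)) (by decide) <| stepTo (P 3 0) (by decide) <| stepTo (P 3 1) (by decide) <|
  stepTo (P 3 2) (by decide) <| stepTo (P 3 3) (by decide) <| stepTo (P 2 3) (by decide) <|
  stepTo (P 1 3) (by decide) <| stepTo (P 0 3) (by decide) <| stepTo (P (-1) 3) (by decide) <|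
  stepTo (P (-1) 2) (by decide) <| stepTo (P (-1) 1) (by decide) <| stepTo (P (-1) 0) (by decide) <|
  stepTo (P (-1) (-1)) (by decide) <| SimpleGraph.Walk.nil

/-- [copy] -/
theorem mem_sq3_support_a' : P 0 (-1) ∈ sq3.support := by decide

/-- [copy] -/
theorem mem_sq3_support_b' : P 2 3 ∈ sq3.support := by decide

/-- [copy] the prover's remaining obligation. -/
def Witness3x3 : Prop :=
  let A : Set (SAW.DomainSAW (dom 1 sq3) 1 (P 0 0) (P 2 2)) := {γ | γ.walk.getVert 1 = P 0 1}
  let B : Set (SAW.DomainSAW (dom 1 sq3) 1 (P 0 0) (P 2 2)) := {γ | γ.walk.reverse.getVert 1 = P 1 2}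
  (∀ γ₁ γ₂, lr γ₁ γ₂ → γ₁ ∈ A → γ₂ ∈ A) ∧ (∀ γ₁ γ₂, lr γ₁ γ₂ → γ₁ ∈ B → γ₂ ∈ B) ∧
    Measure.count A = 6 ∧ Measure.count B = 6 ∧
    Measure.count (Set.univ : Set (SAW.DomainSAW (dom 1 sq3) 1 (P 0 0) (P 2 2))) = 12 ∧
    Measure.count (A ∩ B) = 2

/-- [copy] the refuter's sorry-free reduction. -/
theorem notFKGAtOne_of_witness3x3 (h : Witness3x3) : Theses.SAWLeftRightFKG.NotFKGAtOne := by
  rw [notFKGAtOne_iff]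
  refine ⟨1, P (-1) (-1), P 0 0, P 2 2, P 0 (-1), P 2 3, sq3, fun hC => ?_⟩
  obtain ⟨hA, hB, cA, cB, cU, cAB⟩ := h
  have key := hC one_pos mem_sq3_support_a' mem_sq3_support_b' (by decide) (by decide) _ _ hA hB
  rw [cA, cB, cU, cAB] at key
  have e1 : (6 : ℝ≥0∞) * 6 = ((36 : ℕ) : ℝ≥0∞) := by norm_num
  have e2 : (12 : ℝ≥0∞) * 2 = ((24 : ℕ) : ℝ≥0∞) := by norm_num
  rw [e1, e2] at key
  exact absurd (Nat.cast_le.1 key) (by norm_num)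

end DisproofCopy

open DisproofCopy

/-- The chords of the 3 × 3 witness. -/
abbrev Chord := SAW.DomainSAW (dom 1 sq3) 1 (P 0 0) (P 2 2)

/-- DOMAIN IDENTIFICATION for the refuter's `sq3` (stub; = `adjSq_iff` with `C := sq3`). -/
theorem adj_dom_sq3_iff {x y : Site 2} :
    (discreteDomainGraph (dom 1 sq3) 1).Adj x y ↔
      (zdGraph 2).Adj x y ∧ x ∈ boxSites ![0, 0] ![2, 2] ∧ y ∈ boxSites ![0, 0] ![2, 2] := by
  sorry

/-- Chords stay in the box (from `adj_dom_sq3_iff`, by induction along the walk). -/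
theorem chord_support_subset (γ : Chord) : ∀ v ∈ γ.walk.support, v ∈ boxSites ![0, 0] ![2, 2] := by
  have key : ∀ {u w : Site 2} (p : (discreteDomainGraph (dom 1 sq3) 1).Walk u w),
      u ∈ boxSites ![0, 0] ![2, 2] → ∀ v ∈ p.support, v ∈ boxSites ![0, 0] ![2, 2] := by
    intro u w p
    induction p with
    | nil => intro hu v hv; simp at hv; subst hv; exact hu
    | cons h q ih =>
      intro hu v hv
      rw [SimpleGraph.Walk.support_cons, List.mem_cons] at hv
      rcases hv with rfl | hv
      · exact hu
      · exact ih (adj_dom_sq3_iff.1 h).2.2 v hv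
  exact key γ.walk (by decide)

/-- The first step of a chord leaves the corner upward or to the right (from `adj_dom_sq3_iff`). -/
theorem chord_firstStep (γ : Chord) : γ.walk.getVert 1 = P 0 1 ∨ γ.walk.getVert 1 = P 1 0 := by
  have key : ∀ {u w : Site 2} (p : (discreteDomainGraph (dom 1 sq3) 1).Walk u w), u = P 0 0 → u ≠ w →
      p.getVert 1 = P 0 1 ∨ p.getVert 1 = P 1 0 := by
    intro u w p hu huw
    cases p with
    | nil => exact absurd rfl huw
    | @cons _ v _ h q =>
      subst hu
      rw [show (1 : ℕ) = 0 + 1 from rfl, SimpleGraph.Walk.getVert_cons_succ, SimpleGraph.Walk.getVert_zero]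
      obtain ⟨hadj, -, hv⟩ := adj_dom_sq3_iff.1 h
      rcases zdGraph_adj_cases hadj with rfl | rfl | rfl | rfl
      · right; decide
      · exact absurd hv (by decide)
      · left; decide
      · exact absurd hv (by decide)
  exact key γ.walk rfl (by decide)

/-- CONJUNCT 1 of `Witness3x3` from the source-corner jump (card `one-jump-corner-certificate`). -/
theorem witness3x3_upClosed_A :
    ∀ γ₁ γ₂ : Chord, lr γ₁ γ₂ → γ₁.walk.getVert 1 = P 0 1 → γ₂.walk.getVert 1 = P 0 1 := by
  intro γ₁ γ₂ hle h₁
  exact firstStepUp_upClosed γ₁ γ₂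
    (fun v hv => hv.elim (chord_support_subset γ₁ v) (chord_support_subset γ₂ v))
    (chord_firstStep γ₂) hle h₁

/-- The four counts, reduced to list lengths of the kernel-decided census through the `pathsFrom`
bijection `Chord ≃ chords₃` (stub: `support_mem_pathsFrom` + `exists_walk_of_mem_pathsFrom` +
`walk_eq_of_support_eq` with `nb₃` complete/sound for `dom 1 sq3` by `adj_dom_sq3_iff`, and
`Measure.count` = cardinality on the `⊤` σ-algebra). -/
theorem witness3x3_counts :
    Measure.count {γ : Chord | γ.walk.getVert 1 = P 0 1} = 6 ∧
    Measure.count {γ : Chord | γ.walk.reverse.getVert 1 = P 1 2} = 6 ∧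
    Measure.count (Set.univ : Set Chord) = 12 ∧
    Measure.count ({γ : Chord | γ.walk.getVert 1 = P 0 1} ∩ {γ : Chord | γ.walk.reverse.getVert 1 = P 1 2}) = 2 := by
  sorry

/-- ASSEMBLY SHAPE: the crux from conjunct 1 (proved above modulo the two stubs), conjunct 2 (target-corner
jump, symmetric) and the counts, through the refuter's sorry-free reduction. -/
theorem notFKGAtOne_of_parts
    (hB : ∀ γ₁ γ₂ : Chord, lr γ₁ γ₂ → γ₁.walk.reverse.getVert 1 = P 1 2 → γ₂.walk.reverse.getVert 1 = P 1 2) :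
    Theses.SAWLeftRightFKG.NotFKGAtOne :=
  notFKGAtOne_of_witness3x3
    ⟨witness3x3_upClosed_A, hB, witness3x3_counts.1, witness3x3_counts.2.1, witness3x3_counts.2.2.1,
      witness3x3_counts.2.2.2⟩

end Compose

end

end Summit.CriticalPhenomena.SAWScalingLimit.Cruxes.NotFKGAtOne.SketchIdeator1
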